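import Literature.AlgebraicGeometry.Resolution.PointBlowupResiduallyFinite
import Literature.AlgebraicGeometry.Resolution.BlowupDimension
import Literature.AlgebraicGeometry.Resolution.BlowupsIntegral
import Literature.AlgebraicGeometry.Resolution.HilbertSamuelStrata
import Literature.AlgebraicGeometry.Resolution.ExcellentRingsEssFiniteType
import HarnessLib

/-!
# `H_{X'}(x') ≤ H_X(x)` at residually rational points of the blow-up of a closed point
# (CJS 2020, Thm. 3.10 (1), third inequality, `δ = 0`)

Topic: `Literature/AlgebraicGeometry/Resolution`. Cossart–Jannsen–Saito, LNM 2270, Thm. 3.10 (1)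
(p. 43): for a permissible blow-up `X' = Bℓ_D(X) → X`, `x ∈ D`, `x' ∈ π⁻¹(x)`,
`δ = tr.deg_{k(x)} k(x')`: "`H^{(δ)}_{𝒪_{X',x'}} ≤ H^{(0)}_{𝒪_{X,x}}` and `φ_{X'}(x') ≤ φ_X(x) + δ`
and `H_{X'}(x') ≤ H_X(x)`", where (Def. 2.28) `H_X(x) = H^{(φ_X(x))}_{𝒪_{X,x}}`,
`φ_X(x) = N − ψ_X(x)`. The printed proof of the second inequality (p. 44, (3.7)–(3.8)) is the
dimension formula "`codim_{Y_i}(x) = codim_{Y'_i}(x') + δ`" for the irreducible components, valid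
because "`X` is universally catenary by assumption".

This file PROVES the third inequality `H_{X'}(x') ≤ H_X(x)` — the non-increase of the
Hilbert–Samuel function of CJS along a blow-up, i.e. the input `hmono` of the termination theorem
`Scheme.no_infinite_hsFun_tower` (`HilbertSamuelValues.lean`) — in the cases treated by
`PointBlowupHilbertSamuel.lean` and `PointBlowupResiduallyFinite.lean`: `X` integral, the centre
is the closed point `x` (`J_x = 𝔪_x`), and `x'` is residually rational over `x` (`k(x) = k(x')`;
Singh's sharp form `H^{(0)} ≤ H^{(0)}`), resp. `k(x')` is generated over `k(x)` by finitely many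
algebraic elements — e.g. every closed point of the fibre (Bennett–Hironaka form
`H^{(1)} ≤ H^{(1)}`):

* `surjective_algebraMap_quotient_of_residuallyRational` — bookkeeping: rationality of a prime of
  the chart transported along `reesChartEquiv` to the affine blowup algebra;
* `ringKrullDim_localization_chartRing_eq_of_residuallyIntegral` (and `…_of_residuallyRational`),
  `IsBlowup.ringKrullDim_stalk_eq_of_residuallyIntegral` (and `…_of_residuallyRational`) — **the
  dimension formula at residually integral points: `dim 𝒪_{X',x'} = dim 𝒪_{X,x}`** for a blowing
  up (along ANY ideal sheaf) of an integral locally Noetherian scheme whose local ring `𝒪_{X,x}`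
  is universally catenary, at a point `x'` every germ at which is killed modulo `𝔪_{x'}` by a
  monic polynomial pulled back from `x` (`k(x')/k(x)` algebraic; Matsumura Thm. 15.6 =
  `DimensionFormula.lean`, through the charts as in `BlowupDimension.lean`, which proves `≤`
  without catenarity);
* `Scheme.IsExcellent.isUniversallyCatenaryRing_stalk` — the local rings of an excellent scheme
  are universally catenary (so the hypothesis holds for excellent `X`, CJS's standing assumption);
* `IsBlowup.hsFun_le_of_residuallyRational` — **`H^N_{X'}(x') ≤ H^N_X(x)`** for the blow-up of the
  closed point `x` (`J_x = 𝔪_x`, `J ≠ 0`) of an integral `X` with `𝒪_{X,x}` universally catenary,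
  at every residually rational `x'` over `x`, for every `N`: both points have `ψ = dim 𝒪`
  (integral schemes), the dimensions agree, and `H^{(0)}(𝒪_{X',x'}) ≤ H^{(0)}(𝒪_{X,x})`
  (`IsBlowup.hilbertFun_stalk_le_of_residuallyRational`) is summed `N − dim` times;
* `IsBlowup.hsFun_le_of_residuallyFinite`, `IsBlowup.hsFun_le_of_finite_residueFieldMap` — **the
  same at every point of the fibre with `k(x')/k(x)` finite** (all closed points of the fibre),
  for `N > ψ_X(x)`, from `IsBlowup.hilbertSamuelFun_stalk_le_of_residuallyFinite`
  (Bennett–Hironaka form).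

Not treated: points `x'` with `k(x')/k(x)` transcendental (`δ > 0`), centres of positive
dimension. No definitions and no named facts are introduced.

## Sources

* V. Cossart, U. Jannsen, S. Saito, LNM 2270 (2020), Thm. 3.10 (1) (p. 43) and its proof,
  (3.7)–(3.9) (p. 44); Def. 2.28. [CossartJannsenSaito2020]
* H. Matsumura, *Commutative Ring Theory* (1986), Thm. 15.6. [Matsumura1987]
-/

noncomputable section

open CategoryTheory Polynomial IsLocalRing Literature.RingTheory.HilbertSamuel

namespace Literature.AlgebraicGeometry.Resolution

universe u v w

/-! ## Rationality transported along a presentation -/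

/-- If `ε : D → A` and `ψ : R → A` satisfy `ε ∘ (R → D) = ψ`, `P = ε⁻¹(𝔴)` for an ideal `𝔴 ⊆ A`
over which `R` is residually rational (`R → A/𝔴` onto), and `P` lies over `p`, then
`R/p → D/P` is onto. [folklore] -/
theorem surjective_algebraMap_quotient_of_residuallyRational {R : Type u} {D : Type v} {A : Type w}
    [CommRing R] [CommRing D] [CommRing A] [Algebra R D] (ε : D →+* A) (ψ : R →+* A)
    (hε : ε.comp (algebraMap R D) = ψ) (𝔴 : Ideal A)
    (hrat : Function.Surjective ((Ideal.Quotient.mk 𝔴).comp ψ)) (p : Ideal R)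
    [(𝔴.comap ε).LiesOver p] :
    Function.Surjective (algebraMap (R ⧸ p) (D ⧸ 𝔴.comap ε)) := by
  intro y
  obtain ⟨d, rfl⟩ := Ideal.Quotient.mk_surjective y
  obtain ⟨r, hr⟩ := hrat (Ideal.Quotient.mk 𝔴 (ε d))
  refine ⟨Ideal.Quotient.mk p r, ?_⟩
  rw [Ideal.Quotient.algebraMap_mk_of_liesOver, Ideal.Quotient.mk_eq_mk_iff_sub_mem,
    Ideal.mem_comap, map_sub, ← RingHom.comp_apply, hε, ← Ideal.Quotient.mk_eq_mk_iff_sub_mem]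
  exact hr

/-! ## The dimension formula at residually rational points of the charts -/

/-- **Integrality of the residue extension, transported**: if `ε : D → B` is a ring map with
`ε ∘ (R → D) = ψ` and every element of `B` is killed modulo the ideal `𝔴 ⊆ B` by a monic
polynomial over `R`, then `D/ε⁻¹(𝔴)` is integral over `R/p` for the prime `p` under it. [folklore] -/
theorem isIntegral_quotient_comap_of_residuallyIntegral {R : Type u} {D : Type v} {A : Type w}
    [CommRing R] [CommRing D] [CommRing A] [Algebra R D] (ε : D →+* A) (ψ : R →+* A)
    (hε : ε.comp (algebraMap R D) = ψ) (𝔴 : Ideal A) (p : Ideal R) [(𝔴.comap ε).LiesOver p]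
    (hint : ∀ b : A, ∃ P : R[X], P.Monic ∧ (P.map ψ).eval b ∈ 𝔴) :
    Algebra.IsIntegral (R ⧸ p) (D ⧸ 𝔴.comap ε) := by
  refine ⟨fun d => ?_⟩
  obtain ⟨d₀, rfl⟩ := Ideal.Quotient.mk_surjective d
  obtain ⟨P, hP, hPd⟩ := hint (ε d₀)
  have hmemD : (P.map (algebraMap R D)).eval d₀ ∈ 𝔴.comap ε := by
    rw [Ideal.mem_comap, Polynomial.eval_map, Polynomial.hom_eval₂, hε, ← Polynomial.eval_map]
    exact hPd
  refine ⟨P.map (Ideal.Quotient.mk p), hP.map _, ?_⟩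
  have hcompq : (algebraMap (R ⧸ p) (D ⧸ 𝔴.comap ε)).comp (Ideal.Quotient.mk p) =
      (Ideal.Quotient.mk (𝔴.comap ε)).comp (algebraMap R D) :=
    RingHom.ext fun r => Ideal.Quotient.algebraMap_mk_of_liesOver (𝔴.comap ε) p r
  rw [Polynomial.eval₂_map, hcompq, ← Polynomial.hom_eval₂, Ideal.Quotient.eq_zero_iff_mem,
    ← Polynomial.eval_map]
  exact hmemD

section Chart

variable {R : Type u} [CommRing R] [IsDomain R] [IsLocalRing R] {k : ℕ} (c : Fin k → R) (j : Fin k)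

/-- **`dim S = dim R` for the local rings `S = (B_j)_𝔴` of the charts `B_j = (R[It])_{(c_j t)}`
of `Bl_{(c)}(Spec R)` at residually integral primes `𝔴` over the maximal ideal** of a
universally catenary local domain `R`: every element of `B_j` is killed modulo `𝔴` by a monic
polynomial over `R`, i.e. `B_j/𝔴` is integral over `k = R/𝔪` (Matsumura Thm. 15.6 for
`R ⊆ R[(c)/c_j] ⊆ Frac R`, `DimensionFormula.lean`; the residue extension is algebraic). Without
universal catenarity only `≤` holds (`ringKrullDim_localization_chartRing_le`).
[cite: Matsumura1987, Thm. 15.6] -/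
theorem ringKrullDim_localization_chartRing_eq_of_residuallyIntegral
    (hR : IsUniversallyCatenaryRing R) (𝔴 : Ideal (chartRing c j)) [𝔴.IsPrime]
    (h𝔴 : 𝔴.comap (chartBase c j) = maximalIdeal R)
    (hint : ∀ b : chartRing c j, ∃ P : R[X], P.Monic ∧ (P.map (chartBase c j)).eval b ∈ 𝔴)
    (S : Type u) [CommRing S] [Algebra (chartRing c j) S] [IsLocalization.AtPrime S 𝔴] :
    ringKrullDim S = ringKrullDim R := by
  classical
  haveI : IsNoetherianRing R := hR.1
  -- `B_j` is nontrivial, so `φ(c_j) ≠ 0` and `c_j ≠ 0`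
  haveI : Nontrivial (chartRing c j) :=
    ⟨⟨0, 1, fun h => Ideal.IsPrime.ne_top ‹_› ((Ideal.eq_top_iff_one 𝔴).mpr (h ▸ 𝔴.zero_mem))⟩⟩
  have hcj : chartBase c j (c j) ≠ 0 :=
    nonZeroDivisors.ne_zero (reesChartBase_mem_nonZeroDivisors _ _)
  have hc0 : c j ≠ 0 := fun h => hcj ((congrArg (chartBase c j) h).trans (map_zero _))
  -- `L = R[1/c_j]` is a domain algebraic over `R`, and `D = R[(c)/c_j] ⊆ L`
  haveI : IsDomain (Localization.Away (c j)) :=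
    IsLocalization.isDomain_localization (powers_le_nonZeroDivisors_of_noZeroDivisors hc0)
  haveI : Algebra.IsAlgebraic R (Localization.Away (c j)) :=
    Localization.Away.isAlgebraic_of_ne_zero hc0
  have hinjL : Function.Injective (algebraMap R (Localization.Away (c j))) :=
    IsLocalization.injective (M := Submonoid.powers (c j)) (Localization.Away (c j))
      (powers_le_nonZeroDivisors_of_noZeroDivisors hc0)
  haveI : FaithfulSMul R (blowupAlgebra (Ideal.span (Set.range c)) (c j)) :=
    (faithfulSMul_iff_algebraMap_injective R _).mpr fun a b hab =>
      hinjL (by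
        have := congrArg Subtype.val hab
        exact this)
  haveI : Algebra.FiniteType R (blowupAlgebra (Ideal.span (Set.range c)) (c j)) :=
    finiteType_blowupAlgebra_span_range c j
  haveI : Algebra.IsAlgebraic R (blowupAlgebra (Ideal.span (Set.range c)) (c j)) :=
    Algebra.IsAlgebraic.of_injective (blowupAlgebra (Ideal.span (Set.range c)) (c j)).val
      Subtype.val_injective
  -- `e : B_j ≃ D` (`reesChartEquiv`) and the prime `e(𝔴)` of `D` over `𝔪_R`
  obtain ⟨ε, hε⟩ : ∃ ε : blowupAlgebra (Ideal.span (Set.range c)) (c j) →+* chartRing c j,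
      ε = (reesChartEquiv (c j) (Ideal.mem_span_range_self (f := c) (x := j))).symm.toRingHom :=
    ⟨_, rfl⟩
  have hecomp : ε.comp (algebraMap R _) = chartBase c j := by
    refine RingHom.ext fun r => ?_
    rw [RingHom.comp_apply, hε, ← reesChartEquiv_reesChartBase]
    exact (reesChartEquiv (c j) _).symm_apply_apply _
  haveI : (𝔴.comap ε).IsPrime := Ideal.comap_isPrime ε 𝔴
  haveI : (𝔴.comap ε).LiesOver (maximalIdeal R) :=
    ⟨by rw [Ideal.under_def, Ideal.comap_comap, hecomp, h𝔴]⟩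
  -- the residue extension of `e(𝔴)` over `𝔪_R` is integral, in particular algebraic
  haveI : Algebra.IsAlgebraic (R ⧸ maximalIdeal R)
      (blowupAlgebra (Ideal.span (Set.range c)) (c j) ⧸ 𝔴.comap ε) := by
    haveI : Algebra.IsIntegral (R ⧸ maximalIdeal R)
        (blowupAlgebra (Ideal.span (Set.range c)) (c j) ⧸ 𝔴.comap ε) :=
      isIntegral_quotient_comap_of_residuallyIntegral ε (chartBase c j) hecomp 𝔴 (maximalIdeal R) hint
    haveI : Nontrivial (R ⧸ maximalIdeal R) :=
      Ideal.Quotient.nontrivial_iff.mpr (maximalIdeal.isMaximal R).ne_top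
    exact Algebra.IsIntegral.isAlgebraic
  have hcomapeq : 𝔴.comap ε =
      𝔴.comap (reesChartEquiv (c j) (Ideal.mem_span_range_self (f := c) (x := j))).symm := by
    ext b
    rw [hε]
    rfl
  have hht : (𝔴.comap ε).height = 𝔴.height := by
    rw [hcomapeq]
    exact RingEquiv.height_comap _ 𝔴
  have key := height_eq_height_of_liesOver_of_isUniversallyCatenaryRing hR (maximalIdeal R)
    (𝔴.comap ε)
  rw [hht] at key
  rw [IsLocalization.AtPrime.ringKrullDim_eq_height 𝔴 S, ← IsLocalRing.maximalIdeal_height_eq_ringKrullDim]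
  exact_mod_cast key

/-- The residually rational case of `ringKrullDim_localization_chartRing_eq_of_residuallyIntegral`
(`R → B_j/𝔴` onto: every `b` is congruent to some `φ(r)`, killed by `X − r`).
[cite: Matsumura1987, Thm. 15.6; CossartJannsenSaito2020, proof of Thm. 3.10, (3.8) (p. 44)] -/
theorem ringKrullDim_localization_chartRing_eq_of_residuallyRational
    (hR : IsUniversallyCatenaryRing R) (𝔴 : Ideal (chartRing c j)) [𝔴.IsPrime]
    (h𝔴 : 𝔴.comap (chartBase c j) = maximalIdeal R)
    (hrat : Function.Surjective ((Ideal.Quotient.mk 𝔴).comp (chartBase c j)))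
    (S : Type u) [CommRing S] [Algebra (chartRing c j) S] [IsLocalization.AtPrime S 𝔴] :
    ringKrullDim S = ringKrullDim R := by
  refine ringKrullDim_localization_chartRing_eq_of_residuallyIntegral c j hR 𝔴 h𝔴 (fun b => ?_) S
  obtain ⟨r, hr⟩ := hrat (Ideal.Quotient.mk 𝔴 b)
  refine ⟨Polynomial.X - Polynomial.C r, Polynomial.monic_X_sub_C r, ?_⟩
  rw [Polynomial.map_sub, Polynomial.map_X, Polynomial.map_C, Polynomial.eval_sub,
    Polynomial.eval_X, Polynomial.eval_C, ← Ideal.Quotient.mk_eq_mk_iff_sub_mem]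
  exact hr.symm

end Chart

/-! ## The dimension formula at residually integral points of a blowing up -/

section Scheme

open _root_.AlgebraicGeometry

variable {X X' : Scheme.{u}} {π : X' ⟶ X} {J : X.IdealSheafData}

/-- **`dim 𝒪_{X',x'} = dim 𝒪_{X,x}` at residually integral points of a blowing up** of an
integral locally Noetherian scheme whose local ring at `x = π(x')` is universally catenary (CJS
(3.8) with `δ = 0`: "`codim_{Y}(x) = codim_{Y'}(x') + δ`", from EGA IV (5.6.1) = Matsumura
Thm. 15.6; here through the chart presentation `IsBlowup.exists_reesChart_stalk`). Residual
integrality: every germ at `x'` is killed modulo `𝔪_{x'}` by a monic polynomial with coefficients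
pulled back from `x` (`k(x')/k(x)` algebraic). [cite: CossartJannsenSaito2020, proof of Thm. 3.10, (3.8) (p. 44)] -/
theorem IsBlowup.ringKrullDim_stalk_eq_of_residuallyIntegral [IsIntegral X] [IsLocallyNoetherian X]
    (hπ : IsBlowup π J) (x' : X')
    (hUC : IsUniversallyCatenaryRing (X.presheaf.stalk (π.base x')))
    (hint : ∀ y : X'.presheaf.stalk x', ∃ P : (X.presheaf.stalk (π.base x'))[X], P.Monic ∧
      (P.map (π.stalkMap x').hom).eval y ∈ IsLocalRing.maximalIdeal (X'.presheaf.stalk x')) :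
    ringKrullDim (X'.presheaf.stalk x') = ringKrullDim (X.presheaf.stalk (π.base x')) := by
  obtain ⟨k, c, hc⟩ := Submodule.fg_iff_exists_fin_generating_family.mp
    (IsNoetherian.noetherian (stalkIdeal J (π.base x')))
  obtain ⟨j, 𝔴, χ, hχ, hloc, h𝔴⟩ := hπ.exists_reesChart_stalk x' c hc
  letI := χ.toAlgebra
  haveI : IsLocalization.AtPrime (X'.presheaf.stalk x') 𝔴.asIdeal := hloc
  have hmem : ∀ b : chartRing c j,
      χ b ∈ IsLocalRing.maximalIdeal (X'.presheaf.stalk x') ↔ b ∈ 𝔴.asIdeal := fun b =>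
    IsLocalization.AtPrime.to_map_mem_maximal_iff (X'.presheaf.stalk x') 𝔴.asIdeal b
  have hχc : (π.stalkMap x').hom = χ.comp (chartBase c j) := RingHom.ext fun r => (hχ r).symm
  refine ringKrullDim_localization_chartRing_eq_of_residuallyIntegral c j hUC 𝔴.asIdeal h𝔴
    (fun b => ?_) (X'.presheaf.stalk x')
  obtain ⟨P, hP, hPb⟩ := hint (χ b)
  refine ⟨P, hP, (hmem _).mp ?_⟩
  rw [hχc, ← Polynomial.map_map, Polynomial.eval_map, Polynomial.eval₂_at_apply] at hPb
  exact hPb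

/-- The residually rational case (`k(x) → k(x')` onto: every germ at `x'` is congruent modulo
`𝔪_{x'}` to a germ pulled back from `x`). [cite: CossartJannsenSaito2020, proof of Thm. 3.10, (3.8) (p. 44)] -/
theorem IsBlowup.ringKrullDim_stalk_eq_of_residuallyRational [IsIntegral X] [IsLocallyNoetherian X]
    (hπ : IsBlowup π J) (x' : X')
    (hUC : IsUniversallyCatenaryRing (X.presheaf.stalk (π.base x')))
    (hres : ∀ y : X'.presheaf.stalk x', ∃ r : X.presheaf.stalk (π.base x'),
      y - (π.stalkMap x').hom r ∈ IsLocalRing.maximalIdeal (X'.presheaf.stalk x')) :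
    ringKrullDim (X'.presheaf.stalk x') = ringKrullDim (X.presheaf.stalk (π.base x')) := by
  refine hπ.ringKrullDim_stalk_eq_of_residuallyIntegral x' hUC fun y => ?_
  obtain ⟨r, hr⟩ := hres y
  refine ⟨Polynomial.X - Polynomial.C r, Polynomial.monic_X_sub_C r, ?_⟩
  rw [Polynomial.map_sub, Polynomial.map_X, Polynomial.map_C, Polynomial.eval_sub,
    Polynomial.eval_X, Polynomial.eval_C]
  exact hr

/-- **The local rings of an excellent scheme are universally catenary** (excellent rings are
universally catenary by definition, and `𝒪_{X,x}` is a localization of the excellent ring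
`Γ(X, U)`, `U ∋ x` affine; universal catenarity localizes,
`IsUniversallyCatenaryRing.of_isLocalization`). [cite: Matsumura1987, §32 p. 260 Definition] -/
theorem Scheme.IsExcellent.isUniversallyCatenaryRing_stalk (hX : Scheme.IsExcellent X) (x : X) :
    IsUniversallyCatenaryRing (X.presheaf.stalk x) := by
  obtain ⟨_, ⟨U, hU, rfl⟩, hxU, -⟩ :=
    X.isBasis_affineOpens.exists_subset_of_mem_open (Set.mem_univ x) isOpen_univ
  have hU' : IsAffineOpen U := hU
  letI := TopCat.Presheaf.algebra_section_stalk X.presheaf (⟨x, hxU⟩ : U)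
  haveI := hU'.isLocalization_stalk ⟨x, hxU⟩
  exact IsUniversallyCatenaryRing.of_isLocalization (B := X.presheaf.stalk x)
    (hU'.primeIdealOf ⟨x, hxU⟩).asIdeal.primeCompl (hX ⟨U, hU⟩).1

/-- **CJS Thm. 3.10 (1), `H_{X'}(x') ≤ H_X(x)`, for the blow-up of a closed point at residually
rational points.** Let `X` be an integral locally Noetherian scheme, `π : X' → X` a blowing up
along `J` (`IsBlowup π J`) with `J_x = 𝔪_x` at `x = π(x')` (near `x` the centre is the reduced
closed point `x`), `𝒪_{X,x}` universally catenary (e.g. `X` excellent,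
`Scheme.IsExcellent.isUniversallyCatenaryRing_stalk`), and `x'` residually rational over `x`
(`k(x) → k(x')` onto). Then for every `N` the Hilbert–Samuel functions of Def. 2.28 satisfy
`H^N_{X'}(x') ≤ H^N_X(x)`: both `𝒪_{X,x}` and `𝒪_{X',x'}` are domains (`X'` is integral,
`IsBlowup.isIntegral`), so `ψ_X(x) = dim 𝒪_{X,x} = dim 𝒪_{X',x'} = ψ_{X'}(x')`
(`IsBlowup.ringKrullDim_stalk_eq_of_residuallyRational`), and
`H^{(0)}(𝒪_{X',x'}) ≤ H^{(0)}(𝒪_{X,x})` (`IsBlowup.hilbertFun_stalk_le_of_residuallyRational`)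
gives `H^{(N−ψ)}(𝒪_{X',x'}) ≤ H^{(N−ψ)}(𝒪_{X,x})`. This is the hypothesis `hmono` of
`Scheme.no_infinite_hsFun_tower` at such points.
[cite: CossartJannsenSaito2020, Thm. 3.10 (1) (p. 43), proof (3.9) (p. 44)] -/
theorem IsBlowup.hsFun_le_of_residuallyRational [IsIntegral X] [IsLocallyNoetherian X]
    [IsLocallyNoetherian X'] (hπ : IsBlowup π J) (hJ0 : J ≠ ⊥) (x' : X')
    (hUC : IsUniversallyCatenaryRing (X.presheaf.stalk (π.base x')))
    (hJ : stalkIdeal J (π.base x') = IsLocalRing.maximalIdeal (X.presheaf.stalk (π.base x')))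
    (hres : ∀ y : X'.presheaf.stalk x', ∃ r : X.presheaf.stalk (π.base x'),
      y - (π.stalkMap x').hom r ∈ IsLocalRing.maximalIdeal (X'.presheaf.stalk x')) (N : ℕ) :
    Scheme.hsFun X' N x' ≤ Scheme.hsFun X N (π.base x') := by
  haveI : IsIntegral X' := hπ.isIntegral hJ0
  -- dimensions
  obtain ⟨d, hd⟩ : ∃ d : ℕ, ringKrullDim (X.presheaf.stalk (π.base x')) = d :=
    exists_nat_eq_of_ne_bot_of_ne_top ringKrullDim_ne_bot ringKrullDim_ne_top
  have hd' : ringKrullDim (X'.presheaf.stalk x') = d :=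
    (hπ.ringKrullDim_stalk_eq_of_residuallyRational x' hUC hres).trans hd
  have hψ : Scheme.hsPsi X (π.base x') = d := Scheme.hsPsi_eq_of_isDomain hd
  have hψ' : Scheme.hsPsi X' x' = d := Scheme.hsPsi_eq_of_isDomain hd'
  rw [Scheme.hsFun_def, Scheme.hsFun_def, hψ, hψ', hilbertSamuelFun, hilbertSamuelFun]
  exact iterPSum_mono _ (hπ.hilbertFun_stalk_le_of_residuallyRational x' hJ hres)

/-- **CJS Thm. 3.10 (1), `H_{X'}(x') ≤ H_X(x)` (Bennett–Hironaka form), for the blow-up of a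
closed point at the points of the fibre with finite residue extension** — e.g. all CLOSED points
of the fibre. Hypotheses as in `IsBlowup.hsFun_le_of_residuallyRational`, with residual
rationality replaced by: a finite set `T` of germs at `x'` such that every germ is congruent
modulo `𝔪_{x'}` to a polynomial in `T` with coefficients pulled back from `x`, every element of `T`
being killed modulo `𝔪_{x'}` by a monic polynomial pulled back from `x`; and `N > ψ_X(x)` (so that
`φ = N − ψ ≥ 1`: the Bennett–Hironaka form `H^{(1)}(𝒪_{X',x'}) ≤ H^{(1)}(𝒪_{X,x})`,
`IsBlowup.hilbertSamuelFun_stalk_le_of_residuallyFinite`, summed `φ − 1` more times; the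
dimensions agree by `IsBlowup.ringKrullDim_stalk_eq_of_residuallyIntegral`). This is the
hypothesis `hmono` of `Scheme.no_infinite_hsFun_tower` at such points, for `N > dim X`.
[cite: CossartJannsenSaito2020, Thm. 3.10 (1) (p. 44), proof (3.9) and pp. 46–47] -/
theorem IsBlowup.hsFun_le_of_residuallyFinite [IsIntegral X] [IsLocallyNoetherian X]
    [IsLocallyNoetherian X'] (hπ : IsBlowup π J) (hJ0 : J ≠ ⊥) (x' : X')
    (hUC : IsUniversallyCatenaryRing (X.presheaf.stalk (π.base x')))
    (hJ : stalkIdeal J (π.base x') = IsLocalRing.maximalIdeal (X.presheaf.stalk (π.base x')))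
    (T : Finset (X'.presheaf.stalk x'))
    (hTgen : ∀ y : X'.presheaf.stalk x', ∃ z ∈ Subring.closure
      (Set.range (π.stalkMap x').hom ∪ (T : Set (X'.presheaf.stalk x'))),
      y - z ∈ IsLocalRing.maximalIdeal (X'.presheaf.stalk x'))
    (hTint : ∀ t ∈ T, ∃ P : (X.presheaf.stalk (π.base x'))[X], P.Monic ∧
      (P.map (π.stalkMap x').hom).eval t ∈ IsLocalRing.maximalIdeal (X'.presheaf.stalk x'))
    (N : ℕ) (hN : Scheme.hsPsi X (π.base x') < N) :
    Scheme.hsFun X' N x' ≤ Scheme.hsFun X N (π.base x') := by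
  haveI : IsIntegral X' := hπ.isIntegral hJ0
  have hint := exists_monic_map_eval_mem_of_residuallyFinite (π.stalkMap x').hom T hTgen hTint
  -- dimensions
  obtain ⟨d, hd⟩ : ∃ d : ℕ, ringKrullDim (X.presheaf.stalk (π.base x')) = d :=
    exists_nat_eq_of_ne_bot_of_ne_top ringKrullDim_ne_bot ringKrullDim_ne_top
  have hd' : ringKrullDim (X'.presheaf.stalk x') = d :=
    (hπ.ringKrullDim_stalk_eq_of_residuallyIntegral x' hUC hint).trans hd
  have hψ : Scheme.hsPsi X (π.base x') = d := Scheme.hsPsi_eq_of_isDomain hd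
  have hψ' : Scheme.hsPsi X' x' = d := Scheme.hsPsi_eq_of_isDomain hd'
  rw [Scheme.hsFun_def, Scheme.hsFun_def, hψ, hψ']
  rw [hψ] at hN
  exact hπ.hilbertSamuelFun_stalk_le_of_residuallyFinite x' hJ T hTgen hTint (N - d) (by omega)

/-- **The same at every point `x'` of the fibre with `k(x')/k(x)` finite** (all closed points of
the fibre), finiteness stated for the residue-field map induced by `π^#_{x'}`.
[cite: CossartJannsenSaito2020, Thm. 3.10 (1) (p. 44), proof (3.9) and pp. 46–47] -/
theorem IsBlowup.hsFun_le_of_finite_residueFieldMap [IsIntegral X] [IsLocallyNoetherian X]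
    [IsLocallyNoetherian X'] (hπ : IsBlowup π J) (hJ0 : J ≠ ⊥) (x' : X')
    (hUC : IsUniversallyCatenaryRing (X.presheaf.stalk (π.base x')))
    (hJ : stalkIdeal J (π.base x') = IsLocalRing.maximalIdeal (X.presheaf.stalk (π.base x')))
    (hfin : (IsLocalRing.ResidueField.map (π.stalkMap x').hom).Finite)
    (N : ℕ) (hN : Scheme.hsPsi X (π.base x') < N) :
    Scheme.hsFun X' N x' ≤ Scheme.hsFun X N (π.base x') := by
  obtain ⟨T, hTgen, hTint⟩ :=
    exists_residuallyFinite_of_finite_residueField (π.stalkMap x').hom hfin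
  exact hπ.hsFun_le_of_residuallyFinite hJ0 x' hUC hJ T hTgen hTint N hN

end Scheme

end Literature.AlgebraicGeometry.Resolution

end
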